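import Summits.Ventures.CertifiedManyBodySolver.Downfold.PressureContinuumRecord
import HarnessLib

/-!
# The first typed P-continuum record carrying a DECIDED HUBBARD-BRANCH word: YBa₂Cu₄O₈ (Y-124,
# VSET-v7 M199), and what a first-order structure boundary does to the axis beyond it

Venture CertifiedManyBodySolver, cell `pub/hubbard-downfold`, seat hubbard-downfold-mod-2; namespace
`Summit.Ventures.CertifiedManyBodySolver.Downfold.PCont`. `PressureContinuumRecordLu` typed an
element on the e–ph branch; this file types the record of a CUPRATE whose open interval carries a
decided single-band-Hubbard word (`router/P-INTERVALS.tsv` M199 as of v0.26–v0.34; box #138 STAGE 1,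
lead 2026-08-27T12:21:05Z / v1.1 13:05:21Z):

* columns 0 and 10 GPa, both worded «1BH+3BE» (R3a decided on the Cu plane, `r₁,lo` 0.929 / 1.004 ≥
  `θ_hi`; chain Cu a spectator; 3BE companion) — token `HUB` below;
* the gap (0,10) DECIDED «1BH+3BE — interpolated (P.12e)» (same row, same Ammm low-pressure structure
  at both ends, crossing sets identical, lower-guard margin — kernel `Inflation.y124_0_10_lower_test`);
* NO reach beyond 10 GPa: the printed FIRST-ORDER Ammm → high-pressure transition at [10, 11] GPa
  (15-K Raman in He, ΔV −6 %; REFVALS-3 §5H) makes §P.12(c′)(i) fail at once, so the truth column at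
  14 GPa is UNROUTED — the record says so by construction (`rw = none`).

PROVED (`decide` on the record + KERNEL IV): the items at 0 / 5 / 10 / 14 GPa; `y124_decided_0_10`;
**every pressure of the closed gap [0, 10] GPa carries the Hubbard word** (`y124_word_on_0_10` — the
statement score-1's E18 reading consumes: «an interpolated ROUTER word licenses the branch at that
pressure»), with class «screening» at the two columns and «interpolated» strictly inside
(`y124_conf_inside_0_10`), and **no word at any pressure above 10 GPa** (`y124_no_word_above_10`) —
in particular at the 14-GPa truth column. WHAT THIS IS NOT: a new reading of Y-124 (STAGE-1 box; the
@10 column is PROVISIONAL — transported internals — and re-reads at run-7's stage-2 swap: if the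
one-band width `W₁` prints ≥ 4.18 eV there the @10 word gains an UND:MIXED head and this record is
superseded by one with `gw 0 = none`); not a certified statement about the material (SCREENING-GRADE
words; the structure boundary is a [float] literature statement).
-/

namespace Summit.Ventures.CertifiedManyBodySolver.Downfold

namespace PCont

/-- Router word tokens of record for the Y-124 columns (annotations dropped). [folklore] -/
inductive Y124Word
  /-- «1BH+3BE»: single-band Hubbard box decided on the Cu plane (R3a, `r₁ ≥ θ_hi`) with the
  three-band Emery companion -/
  | HUB
  /-- «UND:MIXED+1BH+3BE»: the straddle head a stage-2 `W₁ ≥ 4.18 eV` print would add at 10 GPa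
  (not taken today; listed for the superseding record) -/
  | UND_MIXED_HUB
  deriving DecidableEq, Repr

open Y124Word

/-- **The Y-124 (M199) P-continuum record of record** (pressures in GPa): columns {0, 10} both `HUB`;
the gap right of 0 decided `HUB`; no gap word right of 10 (no further column); no reach anywhere (the
first-order boundary at [10, 11] GPa forbids a (c′) reach beyond 10). [folklore] -/
def y124Rec : Rec ℕ Y124Word where
  pts := {0, 10}
  cw := fun _ => HUB
  gw := fun P => if P = 0 then some HUB else none
  rw := fun _ => none

/-- At 0 GPa: a computed column carrying the Hubbard word. [folklore] -/
theorem y124_item_0 : (y124Rec.lookup 0).kind = .computed ∧ (y124Rec.lookup 0).word = some HUB := by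
  decide

/-- At 5 GPa (inside (0,10)): an interval item carrying the Hubbard word, class «interpolated».
[folklore] -/
theorem y124_item_5 :
    (y124Rec.lookup 5).kind = .interval ∧ (y124Rec.lookup 5).word = some HUB ∧
      (y124Rec.lookup 5).conf = .interpolated := by
  decide

/-- At 10 GPa: a computed column carrying the Hubbard word (STAGE-1, provisional). [folklore] -/
theorem y124_item_10 :
    (y124Rec.lookup 10).kind = .computed ∧ (y124Rec.lookup 10).word = some HUB := by
  decide

/-- **At 14 GPa — the third truth column, beyond the first-order boundary: UNROUTED, no word.**
[folklore] -/
theorem y124_item_14 :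
    (y124Rec.lookup 14).kind = .unrouted ∧ (y124Rec.lookup 14).word = none ∧
      (y124Rec.lookup 14).conf = .none := by
  decide

/-- 0 and 10 GPa are consecutive computed columns. [folklore] -/
theorem y124_consecutive_0_10 : y124Rec.Consecutive 0 10 := by
  unfold Rec.Consecutive; decide

/-- **The gap (0, 10) is DECIDED with the Hubbard word.** [folklore] -/
theorem y124_decided_0_10 : y124Rec.Decided 0 10 HUB := by
  unfold Rec.Decided Rec.Consecutive; decide

/-- No reach anywhere in the record (the boundary at [10, 11] GPa forbids one beyond 10). [folklore] -/
theorem y124_no_reach (P : ℕ) : y124Rec.rw P = none := rfl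

/-- **Every pressure of the CLOSED gap [0, 10] GPa carries the single-band-Hubbard word** — the
statement the phase-map engines consume («an interpolated ROUTER word licenses the branch at that
pressure»; `Rec.word_eq_on_gap_of_decided`). [folklore] -/
theorem y124_word_on_0_10 {P : ℕ} (h : P ≤ 10) : (y124Rec.lookup P).word = some HUB :=
  Rec.word_eq_on_gap_of_decided y124_decided_0_10 (fun _ _ _ => rfl) (Nat.zero_le P) h

/-- … with class «screening» exactly at 0 and 10 and «interpolated» strictly inside. [folklore] -/
theorem y124_conf_inside_0_10 {P : ℕ} (h₁ : 0 < P) (h₂ : P < 10) :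
    (y124Rec.lookup P).conf = .interpolated :=
  Rec.conf_lookup_of_mem_gap y124_decided_0_10 (fun _ _ _ => rfl) h₁ h₂

/-- The two columns are «screening» items. [folklore] -/
theorem y124_conf_columns :
    (y124Rec.lookup 0).conf = .screening ∧ (y124Rec.lookup 10).conf = .screening :=
  Rec.conf_lookup_ends_of_decided y124_decided_0_10

/-- **No word at ANY pressure above the last column** (no gap to the right of 10, no reach): the axis
beyond a first-order structure boundary is unrouted until a column is computed on the high-pressure
structure. [folklore] -/
theorem y124_no_word_above_10 {P : ℕ} (h : 10 < P) :
    (y124Rec.lookup P).kind = .unrouted ∧ (y124Rec.lookup P).word = none := by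
  have hP : P ∉ y124Rec.pts := by
    simp only [y124Rec, Finset.mem_insert, Finset.mem_singleton]; omega
  have hlook : y124Rec.lookup P = y124Rec.gapItem P := by
    rw [Rec.lookup_of_not_mem _ hP]; rfl
  -- above the highest column there is no computed pressure strictly above `P`
  have habove : ¬(y124Rec.above P).Nonempty := by
    rintro ⟨c, hc⟩
    simp only [Rec.above, y124Rec, Finset.mem_filter, Finset.mem_insert, Finset.mem_singleton] at hc
    omega
  have hgr : y124Rec.gapRight P = none := by
    unfold Rec.gapRight; rw [dif_neg habove]
  have hitem : y124Rec.gapItem P = ⟨.unrouted, none⟩ := by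
    unfold Rec.gapItem; rw [hgr]; cases y124Rec.gapLeft P <;> rfl
  rw [hlook, hitem]; exact ⟨rfl, rfl⟩

end PCont

end Summit.Ventures.CertifiedManyBodySolver.Downfold
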